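import Summits.CriticalPhenomena.PercolationContinuityZ3.Theorems.PercNearOneGluingNoHeavyLowerTailAPLNonuniformDecoupling
import Literature.Probability.Percolation.KozmaNitzanPinning
import HarnessLib

/-!
# `NoHeavyLowerTail` (stmt-CriticalPhenomena-4575) — non-uniform APL, part IV: the pinned laws on the crossing pairs of a glued apex set

Support file (prover seat `prim-cert-1`, gen 16; `--supports stmt-CriticalPhenomena-4575`).  No definitions, no named facts, no sorries.
Part IV of the chain `…APLNonuniformStep` (algebra), `…APLNonuniformPaths/Fibres/Decoupling` (the set-apex BHK slack), `…APLNonuniformPinned`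
(this file), `…APLNonuniformSlack`, `…APLNonuniform` (the theorem).

SETTING.  `μ = prodBernoulli w` on the pairs of `Fin n`; a finset `S` (glued apex: `S ↔ x := ∃ s ∈ S, s ↔ x`), targets `b, c ∉ S`;
`F` = the CROSSING pairs (meeting `S` and `Sᶜ`); for a pattern `ξ ⊆ F`, `ν_ξ = prodBernoulli (pinW w F ξ)` (Kozma–Nitzan toolkit
`KozmaNitzanPinning`) and `R(ξ)` = the outside endpoints of the pairs of `ξ`.  Glued cells: `U0 = {S↮b, S↮c, b↮c}`, `Eab = {S↔b, S↮c}`,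
`Eac = {S↔c, S↮b}`, `ET = {S↔b ∨ S↔c}`, `ED = {b↮c, ¬(S↔b ∧ S↔c)}`.
* `exists_crossing_of_setConn`, `setConn_union_iff` (combinatorics of the pattern); `gluedD_eq_union` (`ED = U0 ⊔ Eab ⊔ Eac`),
  `gluedD_subset_offD` (`ED ⊆ {c ∉ T_b}`);
* `real_eq_sum_pin` — total probability `μ(E) = Σ_{ξ ⊆ F} μ([ξ]_F)·ν_ξ(E)`; `ae_pin_pattern`; `ae_setConn_iff_union` — a.s. under `ν_ξ`,
  `S ↔ x ⟺ (S ∪ R(ξ)) ↔ x`; `pin_real_glued_eq` — hence every Boolean combination of `S↔b, S↔c, b↔c` has the same `ν_ξ`-probability for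
  `S` and for `S ∪ R(ξ)` (this is what makes the induction on `|Sᶜ|` run on a FIXED vertex type, without contracting the apex).
[cite: KozmaNitzan2024, §4 p. 20 (conditioning on the pattern of a finite edge set)]  [this work]
-/

noncomputable section

namespace Summit.CriticalPhenomena.PercolationContinuityZ3.Theorems

namespace APL

open MeasureTheory Literature.Probability.Percolation Literature.Probability.LatticeModels
open scoped Classical

/-! ### Combinatorics of the crossing pattern -/

section Pattern

variable {V : Type*}

/-- If the glued apex set reaches `x ∉ S` then some pair from `S` to `Sᶜ` is open. [folklore] -/
theorem exists_crossing_of_setConn {S : Set V} {x : V} {ω : BondConfig V} (hx : x ∉ S)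
    (h : ∃ s ∈ S, ω ∈ openConn s x) : ∃ s ∈ S, ∃ t, t ∉ S ∧ s(s, t) ∈ ω := by
  obtain ⟨s, hs, t, ht, hst⟩ := (setConn_iff_exit hx).1 h
  exact ⟨s, hs, t, offSet_not_mem hx ht, hst⟩

/-- **Gluing the endpoints of the open crossing pairs**: if every pair `s(s,t)` (`s ∈ S`, `t ∈ R`) listed by `hR` is open, then
`S ↔ x ⟺ (S ∪ R) ↔ x`. [folklore] -/
theorem setConn_union_iff {S R : Set V} {x : V} {ω : BondConfig V}
    (hR : ∀ t ∈ R, t ∉ S ∧ ∃ s ∈ S, s(s, t) ∈ ω) :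
    (∃ s ∈ S, ω ∈ openConn s x) ↔ ∃ s ∈ S ∪ R, ω ∈ openConn s x := by
  constructor
  · rintro ⟨s, hs, h⟩
    exact ⟨s, Or.inl hs, h⟩
  · rintro ⟨u, hu, h⟩
    rcases hu with hu | hu
    · exact ⟨u, hu, h⟩
    · obtain ⟨huS, s, hs, hsu⟩ := hR u hu
      refine ⟨s, hs, ?_⟩
      have hadj : (openGraph ω).Adj s u := by
        rw [openGraph_adj]; exact ⟨hsu, fun h => huS (h ▸ hs)⟩
      exact hadj.reachable.trans h

end Pattern

/-! ### The glued cells: partition and inclusion -/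

section GluedCells

variable {V : Type*} (S : Set V) (b c : V)

/-- `ED = U0 ⊔ Eab ⊔ Eac` pointwise: on `{b ↮ c} ∩ {¬(S↔b ∧ S↔c)}` exactly one of the three cells holds. [folklore] -/
theorem gluedD_eq_union :
    ((openConn b c)ᶜ ∩ ({ω : BondConfig V | ∃ s ∈ S, ω ∈ openConn s b} ∩ {ω | ∃ s ∈ S, ω ∈ openConn s c})ᶜ) =
      ({ω : BondConfig V | ∃ s ∈ S, ω ∈ openConn s b}ᶜ ∩ {ω | ∃ s ∈ S, ω ∈ openConn s c}ᶜ ∩ (openConn b c)ᶜ) ∪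
        (({ω : BondConfig V | ∃ s ∈ S, ω ∈ openConn s b} ∩ {ω | ∃ s ∈ S, ω ∈ openConn s c}ᶜ) ∪
          ({ω : BondConfig V | ∃ s ∈ S, ω ∈ openConn s c} ∩ {ω | ∃ s ∈ S, ω ∈ openConn s b}ᶜ)) := by
  ext ω
  simp only [Set.mem_inter_iff, Set.mem_compl_iff, Set.mem_union, Set.mem_setOf_eq, not_and]
  constructor
  · rintro ⟨hbc, hnot⟩
    by_cases hB : ∃ s ∈ S, ω ∈ openConn s b
    · exact Or.inr (Or.inl ⟨hB, hnot hB⟩)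
    · by_cases hC : ∃ s ∈ S, ω ∈ openConn s c
      · exact Or.inr (Or.inr ⟨hC, hB⟩)
      · exact Or.inl ⟨⟨hB, hC⟩, hbc⟩
  · rintro (⟨⟨hB, hC⟩, hbc⟩ | ⟨hB, hC⟩ | ⟨hC, hB⟩)
    · exact ⟨hbc, fun h => absurd h hB⟩
    · refine ⟨fun hbc => hC ?_, fun _ => hC⟩
      obtain ⟨s, hs, hsb⟩ := hB
      exact ⟨s, hs, (show (openGraph ω).Reachable s b from hsb).trans hbc⟩
    · refine ⟨fun hbc => hB ?_, fun h => absurd h hB⟩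
      obtain ⟨s, hs, hsc⟩ := hC
      exact ⟨s, hs, (show (openGraph ω).Reachable s c from hsc).trans (SimpleGraph.Reachable.symm hbc)⟩

/-- `ED ⊆ {c ∉ T_b}`. [folklore] -/
theorem gluedD_subset_offD :
    ((openConn b c)ᶜ ∩ ({ω : BondConfig V | ∃ s ∈ S, ω ∈ openConn s b} ∩ {ω | ∃ s ∈ S, ω ∈ openConn s c})ᶜ) ⊆
      {ω : BondConfig V | c ∉ openCluster (ω ∩ {e | ∀ x ∈ e, x ∉ S}) b} := by
  rintro ω ⟨hbc, -⟩ hc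
  exact hbc (openCluster_mono Set.inter_subset_left b hc : c ∈ openCluster ω b)

end GluedCells

/-! ### The pinned laws on the crossing pairs of `S` -/

section Pinned

variable {n : ℕ} (w : Sym2 (Fin n) → unitInterval) (S : Finset (Fin n)) (b c : Fin n)

/-- **Law of total probability over the patterns of the crossing pairs** `F = {pairs meeting S and Sᶜ}`. [folklore] -/
theorem real_eq_sum_pin (E : Set (BondConfig (Fin n))) :
    (prodBernoulli w).real E =
      ∑ ξ ∈ (Finset.univ.filter fun e : Sym2 (Fin n) => (∃ x ∈ S, x ∈ e) ∧ ∃ y ∈ e, y ∉ S).powerset,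
        (prodBernoulli w).real (localCylinder
            (↑(Finset.univ.filter fun e : Sym2 (Fin n) => (∃ x ∈ S, x ∈ e) ∧ ∃ y ∈ e, y ∉ S) : Set (Sym2 (Fin n))) ↑ξ) *
          (prodBernoulli (pinW w
            (↑(Finset.univ.filter fun e : Sym2 (Fin n) => (∃ x ∈ S, x ∈ e) ∧ ∃ y ∈ e, y ∉ S) : Set (Sym2 (Fin n))) ↑ξ)).real E := by
  have h := prodBernoulli_real_inter_eq_sum_pinW w
    (Finset.univ.filter fun e : Sym2 (Fin n) => (∃ x ∈ S, x ∈ e) ∧ ∃ y ∈ e, y ∉ S) (A := E) (B := Set.univ)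
    MeasurableSet.of_discrete (determinedBy_univ _)
  rw [Set.inter_univ] at h
  rw [h]
  refine Finset.sum_congr ?_ fun _ _ => rfl
  exact @Finset.filter_true_of_mem _ _ (_) _ fun T _ => Set.mem_univ _

/-- Under the pinned law the pattern on the crossing pairs is a.s. `ξ`. [folklore] -/
theorem ae_pin_pattern (ξ : Finset (Sym2 (Fin n))) :
    ∀ᵐ ω ∂(prodBernoulli (pinW w
        (↑(Finset.univ.filter fun e : Sym2 (Fin n) => (∃ x ∈ S, x ∈ e) ∧ ∃ y ∈ e, y ∉ S) : Set (Sym2 (Fin n))) ↑ξ)),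
      ∀ e ∈ (Finset.univ.filter fun e : Sym2 (Fin n) => (∃ x ∈ S, x ∈ e) ∧ ∃ y ∈ e, y ∉ S), e ∈ ω ↔ e ∈ ξ := by
  filter_upwards [prodBernoulli_pinW_ae_localCylinder w (Finset.finite_toSet _).countable (↑ξ : Set (Sym2 (Fin n)))]
    with ω hω
  intro e he
  have := hω e (Finset.mem_coe.2 he)
  rw [Finset.mem_coe] at this
  exact this

/-- A pair from `S` to `Sᶜ` is a crossing pair. [folklore] -/
theorem mem_crossing {s t : Fin n} (hs : s ∈ S) (ht : t ∉ S) :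
    s(s, t) ∈ (Finset.univ.filter fun e : Sym2 (Fin n) => (∃ x ∈ S, x ∈ e) ∧ ∃ y ∈ e, y ∉ S) :=
  Finset.mem_filter.2 ⟨Finset.mem_univ _, ⟨s, hs, Sym2.mem_mk_left s t⟩, t, Sym2.mem_mk_right s t, ht⟩

/-- **The pinned glued cells of `S` are those of `S ∪ R(ξ)`**, `R(ξ)` = the outside endpoints of the pairs in `ξ`: a.s. under the
pinned law, `S ↔ x ⟺ (S ∪ R(ξ)) ↔ x`. [this work] -/
theorem ae_setConn_iff_union (ξ : Finset (Sym2 (Fin n))) (x : Fin n) :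
    ∀ᵐ ω ∂(prodBernoulli (pinW w
        (↑(Finset.univ.filter fun e : Sym2 (Fin n) => (∃ x ∈ S, x ∈ e) ∧ ∃ y ∈ e, y ∉ S) : Set (Sym2 (Fin n))) ↑ξ)),
      (ω ∈ {ω : BondConfig (Fin n) | ∃ s ∈ (S : Set (Fin n)), ω ∈ openConn s x} ↔
        ω ∈ {ω : BondConfig (Fin n) | ∃ s ∈ (↑(S ∪ Finset.univ.filter fun t : Fin n => t ∉ S ∧ ∃ s ∈ S, s(s, t) ∈ ξ) :
          Set (Fin n)), ω ∈ openConn s x}) := by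
  filter_upwards [ae_pin_pattern w S ξ] with ω hω
  simp only [Finset.coe_union]
  refine setConn_union_iff (S := (S : Set (Fin n))) fun t ht => ?_
  rw [Finset.coe_filter] at ht
  obtain ⟨-, htS, s, hs, hst⟩ := ht
  exact ⟨fun h => htS (Finset.mem_coe.1 h), s, Finset.mem_coe.2 hs, (hω _ (mem_crossing S hs htS)).2 hst⟩

/-- Consequence: a Boolean combination of `S ↔ b`, `S ↔ c` and `b ↔ c` has the same pinned probability for `S` and for `S ∪ R(ξ)`.
[this work] -/
theorem pin_real_glued_eq (ξ : Finset (Sym2 (Fin n))) (Φ : Prop → Prop → Prop → Prop) :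
    (prodBernoulli (pinW w
        (↑(Finset.univ.filter fun e : Sym2 (Fin n) => (∃ x ∈ S, x ∈ e) ∧ ∃ y ∈ e, y ∉ S) : Set (Sym2 (Fin n))) ↑ξ)).real
        {ω | Φ (ω ∈ {ω : BondConfig (Fin n) | ∃ s ∈ (S : Set (Fin n)), ω ∈ openConn s b})
          (ω ∈ {ω : BondConfig (Fin n) | ∃ s ∈ (S : Set (Fin n)), ω ∈ openConn s c}) (ω ∈ openConn b c)} =
      (prodBernoulli (pinW w
        (↑(Finset.univ.filter fun e : Sym2 (Fin n) => (∃ x ∈ S, x ∈ e) ∧ ∃ y ∈ e, y ∉ S) : Set (Sym2 (Fin n))) ↑ξ)).real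
        {ω | Φ (ω ∈ {ω : BondConfig (Fin n) | ∃ s ∈ (↑(S ∪ Finset.univ.filter fun t : Fin n => t ∉ S ∧ ∃ s ∈ S, s(s, t) ∈ ξ) :
            Set (Fin n)), ω ∈ openConn s b})
          (ω ∈ {ω : BondConfig (Fin n) | ∃ s ∈ (↑(S ∪ Finset.univ.filter fun t : Fin n => t ∉ S ∧ ∃ s ∈ S, s(s, t) ∈ ξ) :
            Set (Fin n)), ω ∈ openConn s c}) (ω ∈ openConn b c)} := by
  refine measureReal_congr ?_
  filter_upwards [ae_setConn_iff_union w S ξ b, ae_setConn_iff_union w S ξ c] with ω hb hc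
  exact propext (by
    show Φ _ _ _ ↔ Φ _ _ _
    rw [hb, hc])

end Pinned

end APL

end Summit.CriticalPhenomena.PercolationContinuityZ3.Theorems

end
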